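import Summits.HodgeConjecture.HodgeConjecture.Theorems.AnchorTransportAnchorExistenceChainDefs
import Summits.HodgeConjecture.HodgeConjecture.Theorems.AnchorTransportTargetIffHodgeConjecture
import Summits.HodgeConjecture.HodgeConjecture.Theorems.AnchorTransportAnchorExistenceTransport
import Literature.AlgebraicGeometry.HodgeTheory.MotivatedClassesLefschetzRange
import Literature.AlgebraicGeometry.HodgeTheory.LefschetzOneOneHolds

/-!
# Route AnchorTransport — crux `AnchorExistence` (stmt-HodgeConjecture-1077) · the CHAIN normal form (line `Sketch-peel-to-zero`)

Kernel-checked glue of the line `Sketch-peel-to-zero` (card `Cruxes/AnchorExistence/Ideas/peel-to-zero-chain-anchors.md`,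
skeleton `Cruxes/AnchorExistence/Lines/Sketch_peel_to_zero.lean`, lead a2 2026-08-17) over the route-posited
vocabulary of `AnchorTransportAnchorExistenceChainDefs` (`ChainAnchor.HodgePair / Hop / Surgery / Step /
ChainAnchorAt / Stuck / ChainAnchorExistenceAt`):

* `chainAnchorExistenceAt_of_anchorExistence` — an anchor datum is a ONE-HOP chain: `AnchorExistence → ∀ n p,
  ChainAnchorExistenceAt n p` (unconditionally weaker); `chainAnchorExistenceAt_of_lefschetzRange` — the Lefschetz
  range `p ≤ 1 ∨ n ≤ p + 1` of the chain statement holds NOW (chains of length zero; Lefschetz `(1,1)` and hard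
  Lefschetz are theorems of the tree);
* `mem_algebraicClasses_of_hop / _of_surgery / _of_step / _of_chainAnchorAt` — walking a chain BACK from its
  algebraic end: a hop is paid by the route's other crux `VariationalHodge` (transport of algebraicity of the
  global class from the marked fibre `t` to the fibre `s`) and the route's PROVED `IsoInvariance`; a surgery by
  the group law of `algebraicClasses`;
* `anchorExistence_of_chainAnchorExistenceAt` (registered stub of the skeleton's composition) and
  `chainAnchorExistenceAt_iff_anchorExistence` — MODULO `V` THE CRUX IS THE CHAIN STATEMENT; `closes_of_chain` —
  the route's deciding theorem with `An` replaced by chains; `hodgeConjecture_iff_variationalHodge_and_chain` —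
  the HC-sandwich for the pair `(V, chains)`;
* the RESIDUE CERTIFICATE `chainAnchorAt_iff_mem_algebraicClasses_of_stuck` / `forall_stuck_chainAnchorAt_iff`
  (no `V` involved): on a STUCK pair a chain anchor exists iff the class is already algebraic, so the line's
  residue stub `anchorExistence_stub_chain_stuck : ∀ n p P, Stuck P → ChainAnchorAt P` is VERBATIM the Hodge
  conjecture on stuck pairs — the certificate on which the line was declared dead
  (`Cruxes/AnchorExistence/Lines/Sketch_peel_to_zero.dead.md`); and the lossless split
  `chainAnchorExistenceAt_iff_movable_and_stuck`.
-/

noncomputable section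

-- The mandated namespace `Summit.<P>.<Sub>.Theorems.…` repeats `HodgeConjecture` (single-conjunct summit).
set_option linter.dupNamespace false

namespace Summit.HodgeConjecture.HodgeConjecture.Theorems.ChainAnchor

open CategoryTheory AlgebraicGeometry
open Literature.AlgebraicGeometry Literature.AlgebraicGeometry.Motives
  Literature.AlgebraicGeometry.HodgeTheory Literature.AlgebraicTopology.SingularHomology
open Summit.HodgeConjecture.HodgeConjecture.Theses.AnchorTransport

variable {n p : ℕ}

/-- `(𝟙 X)^* x = x` on elements of `H²ᵖ(X(ℂ); ℂ)` (the identity iso).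
[cite: FultonYoungTableaux1997, Appendix B §B.1 (1)] -/
theorem map_refl_hom_apply {X : SchemeOver ℂ} (x : complexBetti X (2 * p)) :
    complexBetti.map (Iso.refl X).hom (2 * p) x = x := by
  rw [Iso.refl_hom, complexBetti.map_id]
  rfl

/-! ### Chains from anchors and from the Hodge conjecture -/

/-- **An anchor datum is a one-hop chain**: `AnchorExistence → ChainAnchorExistenceAt n p` for all `n p`
(hop from `(X, c)` to the anchor fibre `(𝒳_{s₀}, A|_{𝒳_{s₀}})`, whose class is algebraic; the second
marked iso is the identity of the fibre). [cite: CharlesSchnell2014Notes, Conj. 11.3.1] -/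
theorem chainAnchorExistenceAt_of_anchorExistence (hAn : AnchorExistence) (n p : ℕ) :
    ChainAnchorExistenceAt n p := by
  intro P
  obtain ⟨𝒳, S, f, s₁, s₀, e, A, hf, hirr, hsm, hfib, hAc, hs₀⟩ :=
    hAn P.isSmoothProjective p P.c P.isRationalClass P.isOfHodgeType
  refine ⟨fiberPair f hf A hfib s₀, Relation.ReflTransGen.single (Or.inl ?_), hs₀⟩
  exact ⟨𝒳, S, f, s₁, s₀, e, Iso.refl _, A, hf, hirr, hsm, hfib, hAc, map_refl_hom_apply _⟩

/-- **The Hodge conjecture gives chains of length zero** (the pair itself is the algebraic end).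
[cite: Deligne2000, §1] -/
theorem chainAnchorExistenceAt_of_hodgeConjecture (h : _root_.HodgeConjecture) (n p : ℕ) :
    ChainAnchorExistenceAt n p :=
  fun P ↦ ⟨P, Relation.ReflTransGen.refl,
    (h P.isSmoothProjective).2 _ P.c P.isRationalClass P.isOfHodgeType⟩

/-- **The Lefschetz range of the chain statement holds unconditionally**: for `p ≤ 1` or `n ≤ p + 1` every
Hodge pair is chain-anchored by the EMPTY chain, its class being algebraic on `X` itself by Lefschetz `(1,1)`
and hard Lefschetz — both theorems of the tree (`lefschetzOneOne_rational_holds`,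
`nonempty_hardLefschetzNFold_holds`, assembled in `mem_algebraicClasses_of_lefschetzRange`). So the open part of
both registered chain stubs is the middle range `2 ≤ p ≤ n - 2`.
[cite: VoisinHodgeI2002, Thm. 6.25, Rem. 6.27 and Thm. 11.30] -/
theorem chainAnchorExistenceAt_of_lefschetzRange (hp : p ≤ 1 ∨ n ≤ p + 1) : ChainAnchorExistenceAt n p :=
  fun P ↦ ⟨P, Relation.ReflTransGen.refl,
    mem_algebraicClasses_of_lefschetzRange lefschetzOneOne_rational_holds
      (nonempty_hardLefschetzNFold_holds n P.X) P.isSmoothProjective hp P.c P.isRationalClass P.isOfHodgeType⟩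

/-! ### Walking a chain back: hops are paid by `V`, surgeries by the group law -/

/-- **A surgery is paid by the group law**: if `Surgery P Q` and `Q.c` is algebraic then `P.c` is
algebraic (`P.c = (P.c - e^*Q.c) + e^*Q.c`, and `e^*` preserves algebraic classes by the route's proved
`IsoInvariance`, `anchorTransport_isoInvariance_proof`). [cite: Fulton1998, §19.1] -/
theorem mem_algebraicClasses_of_surgery {P Q : HodgePair n p} (h : Surgery P Q)
    (hQ : Q.c ∈ algebraicClasses Q.X p) : P.c ∈ algebraicClasses P.X p := by
  obtain ⟨e, he⟩ := h
  have h' : complexBetti.map e.hom (2 * p) Q.c ∈ algebraicClasses P.X p :=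
    anchorTransport_isoInvariance_proof e p _ hQ
  simpa using (algebraicClasses P.X p).add_mem he h'

/-- **A hop is paid by the variational Hodge conjecture, backwards**: if `Hop P Q` and `Q.c` is
algebraic then `A|_{𝒳_t} = (e'⁻¹)^*(Q.c)` is algebraic on the fibre `𝒳_t` (`IsoInvariance`), `V`
transports algebraicity of the global class `A` from `t` to `s`, and `P.c = e^*(A|_{𝒳_s})` is algebraic
(`IsoInvariance` again). [cite: CharlesSchnell2014Notes, Conj. 11.3.1 and Prop. 11.3.5] -/
theorem mem_algebraicClasses_of_hop (hV : VariationalHodge) {P Q : HodgePair n p} (h : Hop P Q)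
    (hQ : Q.c ∈ algebraicClasses Q.X p) : P.c ∈ algebraicClasses P.X p := by
  obtain ⟨𝒳, S, f, s, t, e, e', A, hf, hirr, hsm, hfib, hPs, hQt⟩ := h
  have ht : complexBetti.map (fiberι f t) (2 * p) A ∈ algebraicClasses (fiberOver f t) p := by
    have h₁ := anchorTransport_isoInvariance_proof e'.symm p _ hQ
    rwa [← hQt, Iso.symm_hom, e'.complexBetti_map_inv_map_hom] at h₁
  have hs : complexBetti.map (fiberι f s) (2 * p) A ∈ algebraicClasses (fiberOver f s) p :=
    hV f hf hirr hsm p A hfib ⟨t, ht⟩ s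
  rw [← hPs]
  exact anchorTransport_isoInvariance_proof e p _ hs

/-- **One step backwards** (a hop: `V`; a surgery: the group law). [cite: CharlesSchnell2014Notes, Conj. 11.3.1] -/
theorem mem_algebraicClasses_of_step (hV : VariationalHodge) {P Q : HodgePair n p} (h : Step P Q)
    (hQ : Q.c ∈ algebraicClasses Q.X p) : P.c ∈ algebraicClasses P.X p :=
  h.elim (fun hh ↦ mem_algebraicClasses_of_hop hV hh hQ) (fun hs ↦ mem_algebraicClasses_of_surgery hs hQ)

/-- **A whole chain backwards**: under `V`, a chain-anchored pair has an algebraic class (induction on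
the chain from its algebraic end, `Relation.ReflTransGen.head_induction_on`).
[cite: CharlesSchnell2014Notes, Conj. 11.3.1] -/
theorem mem_algebraicClasses_of_chainAnchorAt (hV : VariationalHodge) {P : HodgePair n p}
    (h : ChainAnchorAt P) : P.c ∈ algebraicClasses P.X p := by
  obtain ⟨Q, hPQ, hQ⟩ := h
  induction hPQ using Relation.ReflTransGen.head_induction_on with
  | refl => exact hQ
  | head hstep _ ih => exact mem_algebraicClasses_of_step hV hstep ih

/-- **Pointwise sandwich**: under `V`, a pair `(X, c)` is chain-anchored iff `c` is algebraic (so, modulo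
`V`, the chain statement at a pair is exactly the Hodge conjecture at that pair — stuck or not).
[cite: CharlesSchnell2014Notes, Conj. 11.3.1 and Cor. 11.3.6] -/
theorem chainAnchorAt_iff_mem_algebraicClasses (hV : VariationalHodge) (P : HodgePair n p) :
    ChainAnchorAt P ↔ P.c ∈ algebraicClasses P.X p :=
  ⟨mem_algebraicClasses_of_chainAnchorAt hV, fun h ↦ ⟨P, Relation.ReflTransGen.refl, h⟩⟩

/-! ### Modulo `V` the crux IS the chain statement -/

/-- **Chains have the closing power of the crux, given `V`** (registered stub of the skeleton's
composition): `VariationalHodge → (∀ n p, ChainAnchorExistenceAt n p) → AnchorExistence` — walk the chain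
of `(X, c)` back to make `c` algebraic on `X`, then anchor by the constant family
(`anchorTransport_anchor_of_mem_algebraicClasses`). [cite: CharlesSchnell2014Notes, Conj. 11.3.1] -/
theorem anchorExistence_of_chainAnchorExistenceAt :
    VariationalHodge → (∀ n p : ℕ, ChainAnchorExistenceAt n p) → AnchorExistence := by
  intro hV hCh
  unfold AnchorExistence
  intro n X hX p c hc hpp
  -- the chain from the pair `⟨X, c⟩` makes `c` algebraic on `X` (projections reduced by `dsimp only`)
  have halg := mem_algebraicClasses_of_chainAnchorAt hV (hCh n p ⟨X, c, hX, hc, hpp⟩)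
  dsimp only at halg
  exact anchorTransport_anchor_of_mem_algebraicClasses hX p c hc hpp halg

/-- **Modulo `V` the crux IS the chain statement**: `VariationalHodge → ((∀ n p, ChainAnchorExistenceAt n p)
↔ AnchorExistence)`. [cite: CharlesSchnell2014Notes, Conj. 11.3.1] -/
theorem chainAnchorExistenceAt_iff_anchorExistence (hV : VariationalHodge) :
    (∀ n p : ℕ, ChainAnchorExistenceAt n p) ↔ AnchorExistence :=
  ⟨anchorExistence_of_chainAnchorExistenceAt hV, chainAnchorExistenceAt_of_anchorExistence⟩

/-- **The route's deciding theorem with `An` replaced by chains** (same shape as `AnchorTransport.closes`).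
[cite: CharlesSchnell2014Notes, Conj. 11.3.1] -/
theorem closes_of_chain (hV : VariationalHodge) (hCh : ∀ n p : ℕ, ChainAnchorExistenceAt n p)
    (hIso : IsoInvariance) (hM : HodgeModels) : _root_.HodgeConjecture :=
  closes hV (anchorExistence_of_chainAnchorExistenceAt hV hCh) hIso hM

/-- **HC-sandwich for the pair (`V`, chains)**: the Hodge conjecture is equivalent to `VariationalHodge ∧
∀ n p, ChainAnchorExistenceAt n p` (`→`: `HC → V` is the tree's `anchorTransport_variationalHodge_of_hodgeConjecture`
and chains of length zero; `←`: `closes_of_chain` with the proved `IsoInvariance_holds`, `HodgeModels_holds`).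
So the chain weakening, like the crux, is refutable only by `¬HC`. [cite: CharlesSchnell2014Notes, Cor. 11.3.6] -/
theorem hodgeConjecture_iff_variationalHodge_and_chain :
    _root_.HodgeConjecture ↔ VariationalHodge ∧ ∀ n p : ℕ, ChainAnchorExistenceAt n p :=
  ⟨fun h ↦ ⟨anchorTransport_variationalHodge_of_hodgeConjecture h, chainAnchorExistenceAt_of_hodgeConjecture h⟩,
    fun h ↦ closes_of_chain h.1 h.2 IsoInvariance_holds HodgeModels_holds⟩

/-! ### The residue certificate: on stuck pairs, chains are the Hodge conjecture verbatim -/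

/-- **Residue certificate (no `V` needed): on a STUCK pair a chain anchor exists iff the class is
already algebraic.**  If every pair reachable from `P` is `P` up to an iso `g` and an algebraic
difference, an algebraic end `Q` of a chain gives `g^*(P.c) = Q.c - (Q.c - g^*P.c)` algebraic on `Q.X`,
hence `P.c = (g⁻¹)^*(g^* P.c)` algebraic on `P.X` (`IsoInvariance`); conversely the empty chain.
[cite: Fulton1998, §19.1] -/
theorem chainAnchorAt_iff_mem_algebraicClasses_of_stuck {P : HodgePair n p} (hP : Stuck P) :
    ChainAnchorAt P ↔ P.c ∈ algebraicClasses P.X p := by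
  refine ⟨fun ⟨Q, hPQ, hQ⟩ ↦ ?_, fun h ↦ ⟨P, Relation.ReflTransGen.refl, h⟩⟩
  obtain ⟨g, hg⟩ := hP Q hPQ
  have h₁ : complexBetti.map g.hom (2 * p) P.c ∈ algebraicClasses Q.X p := by
    simpa using (algebraicClasses Q.X p).sub_mem hQ hg
  have h₂ := anchorTransport_isoInvariance_proof g.symm p _ h₁
  rwa [Iso.symm_hom, g.complexBetti_map_inv_map_hom] at h₂

/-- **The stuck part of the chain statement is the Hodge conjecture on stuck pairs, on the nose**:
the line's residue stub `∀ n p P, Stuck P → ChainAnchorAt P` is equivalent to "every rational `(p,p)`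
class on a stuck pair is algebraic". [cite: Fulton1998, §19.1] -/
theorem forall_stuck_chainAnchorAt_iff :
    (∀ (n p : ℕ) (P : HodgePair n p), Stuck P → ChainAnchorAt P) ↔
      ∀ (n p : ℕ) (P : HodgePair n p), Stuck P → P.c ∈ algebraicClasses P.X p :=
  forall₃_congr fun _ _ _ ↦ imp_congr_right fun hP ↦ chainAnchorAt_iff_mem_algebraicClasses_of_stuck hP

/-- **The chain statement splits losslessly into its movable and stuck parts** (excluded middle on
`Stuck P`): the two registered stubs of the skeleton. [cite: Deligne2000, §1] -/
theorem chainAnchorExistenceAt_iff_movable_and_stuck :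
    (∀ n p : ℕ, ChainAnchorExistenceAt n p) ↔
      (∀ (n p : ℕ) (P : HodgePair n p), ¬ Stuck P → ChainAnchorAt P) ∧
        (∀ (n p : ℕ) (P : HodgePair n p), Stuck P → ChainAnchorAt P) :=
  ⟨fun h ↦ ⟨fun n p P _ ↦ h n p P, fun n p P _ ↦ h n p P⟩,
    fun h n p P ↦ (em (Stuck P)).elim (h.2 n p P) (h.1 n p P)⟩

/-- **A stuck pair with algebraic class is trivially chain-anchored; a stuck pair with NON-algebraic class
is chain-anchored by NO chain** — the contrapositive form of the certificate used in the dead-line note: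
for stuck `P`, `¬ (P.c ∈ algebraicClasses P.X p) → ¬ ChainAnchorAt P`. [cite: Fulton1998, §19.1] -/
theorem not_chainAnchorAt_of_stuck_of_not_mem {P : HodgePair n p} (hP : Stuck P)
    (hc : P.c ∉ algebraicClasses P.X p) : ¬ ChainAnchorAt P :=
  fun h ↦ hc ((chainAnchorAt_iff_mem_algebraicClasses_of_stuck hP).1 h)

/-! ### Consequences for the crux itself and for the planners' split -/

/-- **On a stuck pair the ONE-HOP crux is the Hodge conjecture verbatim, too**: an anchor datum of
`(P.X, P.c)` (the `∃`-body of `AnchorExistence`) is a one-hop chain to the anchor fibre, so for stuck `P`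
it exists iff `P.c` is already algebraic (`→`: the residue certificate; `←`: the constant-family anchor
`anchorTransport_anchor_of_mem_algebraicClasses`). This types the tightness remark of the earlier dead-line
notes ("An-rigid pairs": p90042 / `Negative/ConstantClause` p103021) over the chain vocabulary.
[cite: CharlesSchnell2014Notes, Conj. 11.3.1] -/
theorem anchor_iff_mem_algebraicClasses_of_stuck {P : HodgePair n p} (hP : Stuck P) :
    (∃ (𝒳 S : SchemeOver ℂ) (f : 𝒳 ⟶ S) (s₁ s₀ : ComplexPoints S) (e : P.X ≅ fiberOver f s₁)
      (A : complexBetti 𝒳 (2 * p)),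
      IsSmoothProjectiveFamily f n ∧ IrreducibleSpace S.left ∧ AlgebraicGeometry.Smooth S.hom ∧
      (∀ s : ComplexPoints S, IsRationalClass (complexBetti.map (fiberι f s) (2 * p) A) ∧
        IsOfHodgeType n (fiberOver f s) (2 * p) p p (complexBetti.map (fiberι f s) (2 * p) A)) ∧
      complexBetti.map e.hom (2 * p) (complexBetti.map (fiberι f s₁) (2 * p) A) = P.c ∧
      complexBetti.map (fiberι f s₀) (2 * p) A ∈ algebraicClasses (fiberOver f s₀) p) ↔
    P.c ∈ algebraicClasses P.X p := by
  refine ⟨fun ⟨𝒳, S, f, s₁, s₀, e, A, hf, hirr, hsm, hfib, hAc, hs₀⟩ ↦ ?_, fun h ↦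
    anchorTransport_anchor_of_mem_algebraicClasses P.isSmoothProjective p P.c P.isRationalClass
      P.isOfHodgeType h⟩
  refine (chainAnchorAt_iff_mem_algebraicClasses_of_stuck hP).1
    ⟨fiberPair f hf A hfib s₀, Relation.ReflTransGen.single (Or.inl ?_), hs₀⟩
  exact ⟨𝒳, S, f, s₁, s₀, e, Iso.refl _, A, hf, hirr, hsm, hfib, hAc, map_refl_hom_apply _⟩

/-- **Glue for the mobility split of the crux** (for the planners; consumes the route's other crux `V`):
`VariationalHodge →` (every MOVABLE pair is chain-anchored) `→` (HC on STUCK pairs) `→ AnchorExistence`.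
[cite: CharlesSchnell2014Notes, Conj. 11.3.1] -/
theorem anchorExistence_of_variationalHodge_of_movable_of_stuck :
    VariationalHodge → (∀ (n p : ℕ) (P : HodgePair n p), ¬ Stuck P → ChainAnchorAt P) →
      (∀ (n p : ℕ) (P : HodgePair n p), Stuck P → P.c ∈ algebraicClasses P.X p) → AnchorExistence :=
  fun hV hmov hstuck ↦ anchorExistence_of_chainAnchorExistenceAt hV
    (chainAnchorExistenceAt_iff_movable_and_stuck.2 ⟨hmov, forall_stuck_chainAnchorAt_iff.2 hstuck⟩)

end Summit.HodgeConjecture.HodgeConjecture.Theorems.ChainAnchor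

end
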